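/-
Copyright: the b2b-balaban T⁴-continuum CRUX team, row NE7b owner lineage `t4-ne7b-p1` (gen 116). Project licence.
-/
import Summits.QuantumFields.BalabanUV.T4Continuum.Spine.NE7b.SupBackgroundGradientLocalised
import Summits.QuantumFields.BalabanUV.T4Continuum.Spine.NE7b.SupBackgroundRegionLetters

/-!
# THE SMALL-FIELD REGION LETTERS OF THE INTERACTING BACKGROUND, ASSEMBLED: for (60)'s background `σ` on `ℓ^∞(ℤ^d)` (`d ≥ 3`, every
# side, one `A′`) and any admissible rate `μ`, two coarse fields in the chart ball that agree to within `ω` on the `D` blocks around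
# `blk p` produce backgrounds with `|(σw′ − σw)(p)| ≤ K₁(μ)·(ω + ‖w′ − w‖e^{−μD})` and
# `|∇_ν(σw′ − σw)(p)| ≤ (n+1)⁻¹·K₁′(μ)·(ω + ‖w′ − w‖e^{−μD})`, and constant coarse fields are their own backgrounds — so a coarse field
# `ω`-close to a constant `c` near `p` has background `c + O(ω + e^{−μD})` at `p` with η-gradient `O(ω + e^{−μD})` there: print's
# small-field region implication, in the sup currency (row NE7b, node U5c; (60) ∕ (63) ∕ the owner's gradient and region files BY NAME; [folklore])

Cell `pub-balaban`, sub-cell `t4`, spine estimate NE7b (`T4WeightBudget.RelWeightBound`; the cell's OWN estimate — NOT PRINTED in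
[Bałaban 1983–89], NOT PROVED).  Crux-route work under `Spine/NE7b/` by the row OWNER (`t4-ne7b-p1` gen 116) under FREEZE (0)'s
crux-prover clause (FILING-CLAIM C-ne7bp1-g116-9); NOTHING of Bałaban's is named, valued or asserted; no `T4Continuum/Support` leaf
typed; no `def`, no notation; zero `sorry`.  Imports (BY NAME): the owner's `…SupBackgroundGradientLocalised`
(`exists_chart_gradient_weighted`, `weighted_diff_le_of_background_pair`; through it (63) `…SupBackgroundLocalisation.weighted_apriori`,
(60) `exists_background`, (58) `exists_clm_mul`, `abs_apply_le_norm`) and `…SupBackgroundRegionLetters` (`abs_le_two_radius_of_coarse_letter`,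
`background_const_of_letters`).

WHY (located).  The locality column of the sup road was typed as WEIGHTED letters ((62)–(66), (63) `weighted_apriori`, (64)'s modulus
letters via the conjugated mean-value theorem, the owner's gradient rows) plus READERS ((63) §3 far support, (71), the two-radius
reader).  The sentence a small-field analysis consumes is the assembled one: «if the coarse field is within `ω` of `w` (resp. of a
constant) on the blocks within `D` of `p`, the background and its η-gradient at `p` move by `O(ω + e^{−μD})`».  The assembly is short
because the DIFFERENCE of two solutions of the sitewise background system solves (63)'s linearised constrained system with the diagonal
multiplier `g = (u∘φ − u∘ψ)∕(φ − ψ)` (a difference quotient, `|g| ≤ λ` for `λ`-Lipschitz `u`) and ZERO fibre datum — so (63)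
`weighted_apriori` IS the weighted value letter of the pair (§1; no derivative, no convexity of the ball, any two solutions), the owner's
pair gradient letter takes it as its `R`, and the two-radius reader turns both into region letters (§2); (60) supplies the pair
`(σw′, σw)` and the region file the constant backgrounds (§3).

WHAT IS PROVED ([folklore]; `ℓ^∞ := lp (fun _ : X d => ℝ) ∞`; `C_H(μ) := cHs·K_d(δ_H − μ)`, `C_G(μ) := A_G·K_d(δ_u∕4 − μ)`,
`C_Γ(μ) := C_G(μ)(1 + C_H(μ))`, `K₁(μ) := (1 − 2λC_Γ(μ))⁻¹C_H(μ)`, `C_Γ′(μ) := A′K_d(δ_u∕4 − μ) + C_H(μ)C_G(μ)`,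
`K₁′(μ) := C_H(μ) + C_Γ′(μ)·2λK₁(μ)`, all written out):
* §1 **`weighted_pair_apriori`** — (63) §1's operators, `u` `λ`-Lipschitz, `0 ≤ μ < δ_H ∧ δ_u∕4`, `2λC_Γ(μ) < 1`, `ρ` bounded admissible,
  two solutions `φ, ψ ∈ ℓ^∞` of the sitewise background system, `e^{μρ}|Q′(φ − ψ)| ≤ R_v` ⟹ `e^{μρ(blk p)}|(φ − ψ)(p)| ≤ K₁(μ)R_v`.
* §1 also `exists_lipschitz_extension` (a window-Lipschitz term agrees on the window with a globally Lipschitz one — the clamp).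
* §2 **`region_pair_value`**, **`region_pair_gradient`** — generic in the operators (+ the owner's weighted chart-gradient letter for §2b),
  for a term `u` that is `λ`-Lipschitz on a WINDOW `|t| ≤ ρ_u` containing the values of `φ, ψ` (so `φ⁴`-type terms are covered):
  `|Q′(φ − ψ)| ≤ ω` on `{y : |y − blk p|_∞ < D}` ⟹ `|(φ − ψ)(p)| ≤ K₁(μ)(ω + ‖Q′(φ − ψ)‖e^{−μD})`,
  `|(φ − ψ)(p+e_ν) − (φ − ψ)(p)| ≤ (n+1)⁻¹K₁′(μ)(ω + ‖Q′(φ − ψ)‖e^{−μD})`.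
* §3 **`exists_background_region`** — `d ≥ 3`, `a > 0`, (60)'s data and an admissible rate `μ`: ONE `A′ ≥ 0` and, for every side,
  (60)'s `Q′, A, P, σ` with the displayed actions, `σ 0 = 0`, the closed-ball letters, Lipschitz, AND: for `w, w′` in the chart ball,
  `0 ≤ ω`, `|w′ − w| ≤ ω` on the `D`-ball of `blk p`: **`|(σw′ − σw)(p)| ≤ K₁(μ)(ω + ‖w′ − w‖e^{−μD})`** and
  **`|∇_ν(σw′ − σw)(p)| ≤ (n+1)⁻¹K₁′(μ)(ω + ‖w′ − w‖e^{−μD})`**; and every constant field `φ ≡ c` with `‖φ‖ ≤ r` has `Q′φ = φ`, `σφ = φ`.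
* §4 toy.

HONEST (what this is NOT).  Constants ∕ rates existential and useless by value at small sides; forward differences; the rate `μ` is a
hypothesis (a positive admissible one exists by (64) `exists_admissible_rate`); scalar `ℤ^d`, sitewise interaction, hard constraint;
nothing of the covariant `H_k`, (A3) ∕ (A1c) (NC-NE7b-α UNRULED).  BY-NAME EFFECT ON THE WALL: NONE.  NE7b NOT PRINTED ∕ NOT PROVED; spine
PROVED 0∕9; rung (B)+1 on a FINITE torus — NOT infinite volume, NOT the mass gap, NOT Clay.  HONEST DEPENDENCY: continuum YM on T⁴ ⇐
BetaPertH ∧ nine spine estimates (0∕9 proved); BetaPertH ⇐ (D1) ∧ (D4) ∧ CAP+tail; G-an2-4 gates asym, D1 and NE2∕3∕4.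
-/

set_option autoImplicit false

noncomputable section

namespace Summit.QuantumFields.BalabanUV.T4Continuum.NE7b.SupBackgroundRegionInstance

open scoped ENNReal NNReal
open Metric Set
open Literature.MathematicalPhysics.QuantumFieldTheory.Balaban1983to89
open B4Sect5Proof (latticeConst latticeConst_nonneg)
open B6QGQLower276 (X e blk B mem_B sum_B_const AX)
open B6QGQDecay237 (deltaU deltaU_pos)
open B5Hk103ScalarZd (nbhd deltaH deltaH_pos)
open Summit.QuantumFields.BalabanUV.Beta.D1BFx.BlockColumnSupNorm (cHs cHs_nonneg)
open Summit.QuantumFields.BalabanUV.Beta.D1BFx.PointColumnSplit (cKL cG0 cSplit)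
open Summit.QuantumFields.BalabanUV.Beta.D1BFx.PointColumnDecay (cFar)
open BlockPropagatorSupNorm (supConstG_nonneg)
open LocalNemytskiiSup (abs_apply_le_norm exists_clm_mul)
open AugmentedSupEquivalence (blockAvg_fibreProj)
open SupSmallFieldBackground (exists_background)
open SupBackgroundLocalisation (weighted_apriori)
open SupBackgroundGradientLocalised (exists_chart_gradient_weighted weighted_diff_le_of_background_pair)
open SupBackgroundRegionLetters (abs_le_two_radius_of_coarse_letter background_const_of_letters)

variable {d : ℕ}

/-! ## §1. The weighted value letter of a pair of solutions -/

/-- **A WINDOW-LIPSCHITZ SITEWISE TERM HAS A GLOBALLY LIPSCHITZ EXTENSION**: if `|u s − u t| ≤ λ|s − t|` for `|s|, |t| ≤ ρ`, then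
`ũ := u ∘ clamp_ρ` is `λ`-Lipschitz on `ℝ` and agrees with `u` on the window — so every letter below stated for a globally Lipschitz term
applies to fields with values in the window (the `φ⁴`-type terms of leaf-04's LNSB ∕ the owner's `…SupPhiFourBackground`). [folklore] -/
theorem exists_lipschitz_extension {u : ℝ → ℝ} {lam ρ : ℝ} (hρ : 0 ≤ ρ)
    (hu : ∀ s t, |s| ≤ ρ → |t| ≤ ρ → |u s - u t| ≤ lam * |s - t|) (hlam : 0 ≤ lam) :
    ∃ v : ℝ → ℝ, (∀ s t, |v s - v t| ≤ lam * |s - t|) ∧ ∀ t, |t| ≤ ρ → v t = u t := by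
  refine ⟨fun t => u (max (min t ρ) (-ρ)), fun s t => ?_, fun t ht => ?_⟩
  · have hcs : |max (min s ρ) (-ρ)| ≤ ρ := abs_le.2 ⟨le_max_right _ _, max_le (min_le_right _ _) (by linarith)⟩
    have hct : |max (min t ρ) (-ρ)| ≤ ρ := abs_le.2 ⟨le_max_right _ _, max_le (min_le_right _ _) (by linarith)⟩
    refine (hu _ _ hcs hct).trans (mul_le_mul_of_nonneg_left ?_ hlam)
    have h1 : |min s ρ - min t ρ| ≤ |s - t| :=
      (abs_min_sub_min_le_max s ρ t ρ).trans (by rw [sub_self, abs_zero]; exact max_le le_rfl (abs_nonneg _))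
    exact (abs_max_sub_max_le_abs _ _ _).trans h1
  · obtain ⟨h1, h2⟩ := abs_le.1 ht
    show u (max (min t ρ) (-ρ)) = u t
    rw [min_eq_left h2, max_eq_left h1]


/-- The difference quotient of a `λ`-Lipschitz function is a diagonal multiplier of size `≤ λ` reproducing the difference. [folklore] -/
theorem exists_diffQuotient {u : ℝ → ℝ} {lam : ℝ} (hlam0 : 0 ≤ lam) (hu : ∀ s t, |u s - u t| ≤ lam * |s - t|) (φ ψ : X d → ℝ) :
    ∃ g : X d → ℝ, (∀ q, |g q| ≤ lam) ∧ ∀ q, g q * (φ q - ψ q) = u (φ q) - u (ψ q) := by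
  refine ⟨fun q => if φ q - ψ q = 0 then 0 else (u (φ q) - u (ψ q)) / (φ q - ψ q), fun q => ?_, fun q => ?_⟩
  · by_cases h : φ q - ψ q = 0
    · simp only [h, ↓reduceIte, abs_zero]; exact hlam0
    · simp only [h, ↓reduceIte, abs_div]
      rw [div_le_iff₀ (abs_pos.2 h)]
      exact hu _ _
  · beta_reduce
    by_cases h : φ q - ψ q = 0
    · have e : φ q = ψ q := sub_eq_zero.1 h
      rw [if_pos h, zero_mul, e, sub_self]
    · rw [if_neg h]; exact div_mul_cancel₀ _ h

/-- **THE WEIGHTED VALUE LETTER OF A PAIR OF SOLUTIONS OF THE BACKGROUND SYSTEM** (`d ≥ 3`; (63) §1's operators; `u` `λ`-Lipschitz;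
admissible `(μ, ρ)` with `2λC_Γ(μ) < 1`, `ρ` bounded): if `Aφ + u∘φ` and `Aψ + u∘ψ` are block-constant and `e^{μρ(y)}|Q′(φ − ψ)(y)| ≤ R_v`,
then `e^{μρ(blk p)}|(φ − ψ)(p)| ≤ (1 − 2λC_Γ(μ))⁻¹·C_H(μ)·R_v` — (63) `weighted_apriori` on `h = φ − ψ` with the difference-quotient
multiplier and zero fibre datum. [folklore] -/
theorem weighted_pair_apriori (hd : 3 ≤ d) (n : ℕ) {a : ℝ} (ha : 0 < a)
    (Dop Aop Pop : lp (fun _ : X d => ℝ) ∞ →L[ℝ] lp (fun _ : X d => ℝ) ∞)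
    (hD : ∀ (f : lp (fun _ : X d => ℝ) ∞) (y : X d), Dop f y = (((n : ℝ) + 1) ^ d)⁻¹ * ∑ p ∈ B n y, f p)
    (hA : ∀ (f : lp (fun _ : X d => ℝ) ∞) (p : X d), Aop f p = ∑ r ∈ nbhd n p, AX n a p r * f r)
    (hP : ∀ (f : lp (fun _ : X d => ℝ) ∞) (p : X d), Pop f p = f p - (((n : ℝ) + 1) ^ d)⁻¹ * ∑ p' ∈ B n (blk n p), f p')
    {u : ℝ → ℝ} {lam : ℝ} (hlam0 : 0 ≤ lam) (hu : ∀ s t, |u s - u t| ≤ lam * |s - t|)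
    {μ : ℝ} (hμ0 : 0 ≤ μ) (hμH : μ < deltaH d a) (hμU : μ < deltaU d a / 4)
    (hsmall : 2 * lam * (((cG0 d * cKL d (d - 2) + cSplit d a) * Real.exp (2 * deltaU d a)
        + cFar d a * Real.exp (4 * deltaU d a) / deltaU d a ^ 2) * latticeConst d (deltaU d a / 4 - μ)
          * (1 + cHs d a * latticeConst d (deltaH d a - μ))) < 1)
    {ρ : X d → ℝ} (hρ : ∀ x y, ρ x - ρ y ≤ dist x y) {Mρ : ℝ} (hρb : ∀ y, |ρ y| ≤ Mρ)
    {φ ψ : lp (fun _ : X d => ℝ) ∞}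
    (hφ : ∀ p : X d, Aop φ p + u (φ p) = (((n : ℝ) + 1) ^ d)⁻¹ * ∑ p' ∈ B n (blk n p), (Aop φ p' + u (φ p')))
    (hψ : ∀ p : X d, Aop ψ p + u (ψ p) = (((n : ℝ) + 1) ^ d)⁻¹ * ∑ p' ∈ B n (blk n p), (Aop ψ p' + u (ψ p')))
    {Rv : ℝ} (hv : ∀ y, Real.exp (μ * ρ y) * |Dop (φ - ψ) y| ≤ Rv) (p : X d) :
    Real.exp (μ * ρ (blk n p)) * |(φ - ψ) p|
      ≤ (1 - 2 * lam * (((cG0 d * cKL d (d - 2) + cSplit d a) * Real.exp (2 * deltaU d a)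
            + cFar d a * Real.exp (4 * deltaU d a) / deltaU d a ^ 2) * latticeConst d (deltaU d a / 4 - μ)
              * (1 + cHs d a * latticeConst d (deltaH d a - μ))))⁻¹
        * (cHs d a * latticeConst d (deltaH d a - μ) * Rv) := by
  obtain ⟨g, hg, hgid⟩ := exists_diffQuotient hlam0 hu (fun q => φ q) (fun q => ψ q)
  obtain ⟨Nop, hN, -⟩ := exists_clm_mul (ι := X d) g hlam0 hg
  -- `P(A(φ − ψ) + g·(φ − ψ)) = 0`: the summand is the difference of two block-constant fields
  have hsum : ∀ q, (Aop (φ - ψ) + Nop (φ - ψ)) q = (Aop φ q + u (φ q)) - (Aop ψ q + u (ψ q)) := fun q => by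
    rw [lp.coeFn_add, Pi.add_apply, hN, map_sub, lp.coeFn_sub, Pi.sub_apply, lp.coeFn_sub, Pi.sub_apply, hgid]
    ring
  have h2 : Pop (Aop (φ - ψ) + Nop (φ - ψ)) = 0 := lp.ext (funext fun q => by
    rw [hP, lp.coeFn_zero, Pi.zero_apply, hsum, Finset.sum_congr rfl fun p' _ => hsum p', Finset.sum_sub_distrib, mul_sub,
      ← hφ q, ← hψ q, sub_self])
  have hz : ∀ q : X d, Real.exp (μ * ρ (blk n q)) * |(0 : lp (fun _ : X d => ℝ) ∞) q| ≤ 0 := fun q => by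
    rw [lp.coeFn_zero, Pi.zero_apply, abs_zero, mul_zero]
  have h := weighted_apriori hd n ha Dop Aop Pop Nop hD hA hP hN hg hμ0 hμH hμU hsmall hρ hρb (φ - ψ) (Dop (φ - ψ)) 0
    (map_zero Dop) rfl h2 hv hz p
  rwa [mul_zero, add_zero] at h

/-! ## §2. The region letters of a pair, generic in the operators -/

section Region

variable {n : ℕ} {a : ℝ} {Dop Aop Pop : lp (fun _ : X d => ℝ) ∞ →L[ℝ] lp (fun _ : X d => ℝ) ∞} {u : ℝ → ℝ} {lam μ : ℝ}
  {φ ψ : lp (fun _ : X d => ℝ) ∞}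

/-- **THE REGION LETTER FOR THE VALUE OF A PAIR** (`d ≥ 3`; §1's standing hypotheses with `u` `λ`-Lipschitz on a window `|t| ≤ ρ_u`
containing the values of `φ` and `ψ`): if the block means of `φ − ψ` are `≤ ω` on
`{y : |y − blk p|_∞ < D}` (`ω ≥ 0`), then `|(φ − ψ)(p)| ≤ K₁(μ)·(ω + ‖Q′(φ − ψ)‖·e^{−μD})`. [folklore] -/
theorem region_pair_value (hd : 3 ≤ d) (ha : 0 < a)
    (hD : ∀ (f : lp (fun _ : X d => ℝ) ∞) (y : X d), Dop f y = (((n : ℝ) + 1) ^ d)⁻¹ * ∑ p ∈ B n y, f p)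
    (hA : ∀ (f : lp (fun _ : X d => ℝ) ∞) (p : X d), Aop f p = ∑ r ∈ nbhd n p, AX n a p r * f r)
    (hP : ∀ (f : lp (fun _ : X d => ℝ) ∞) (p : X d), Pop f p = f p - (((n : ℝ) + 1) ^ d)⁻¹ * ∑ p' ∈ B n (blk n p), f p')
    (hlam0 : 0 ≤ lam) {ρu : ℝ} (hρu : 0 ≤ ρu) (hu : ∀ s t, |s| ≤ ρu → |t| ≤ ρu → |u s - u t| ≤ lam * |s - t|)
    (hμ0 : 0 ≤ μ) (hμH : μ < deltaH d a) (hμU : μ < deltaU d a / 4)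
    (hsmall : 2 * lam * (((cG0 d * cKL d (d - 2) + cSplit d a) * Real.exp (2 * deltaU d a)
        + cFar d a * Real.exp (4 * deltaU d a) / deltaU d a ^ 2) * latticeConst d (deltaU d a / 4 - μ)
          * (1 + cHs d a * latticeConst d (deltaH d a - μ))) < 1)
    (hφρ : ∀ q, |φ q| ≤ ρu) (hψρ : ∀ q, |ψ q| ≤ ρu)
    (hφ : ∀ p : X d, Aop φ p + u (φ p) = (((n : ℝ) + 1) ^ d)⁻¹ * ∑ p' ∈ B n (blk n p), (Aop φ p' + u (φ p')))
    (hψ : ∀ p : X d, Aop ψ p + u (ψ p) = (((n : ℝ) + 1) ^ d)⁻¹ * ∑ p' ∈ B n (blk n p), (Aop ψ p' + u (ψ p')))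
    (p : X d) {D ω : ℝ} (hω : 0 ≤ ω) (hnear : ∀ y, dist y (blk n p) < D → |Dop (φ - ψ) y| ≤ ω) :
    |(φ - ψ) p|
      ≤ (1 - 2 * lam * (((cG0 d * cKL d (d - 2) + cSplit d a) * Real.exp (2 * deltaU d a)
            + cFar d a * Real.exp (4 * deltaU d a) / deltaU d a ^ 2) * latticeConst d (deltaU d a / 4 - μ)
              * (1 + cHs d a * latticeConst d (deltaH d a - μ))))⁻¹
          * (cHs d a * latticeConst d (deltaH d a - μ))
        * (ω + ‖Dop (φ - ψ)‖ * Real.exp (-(μ * D))) := by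
  -- replace `u` by its globally Lipschitz extension off the window: the two systems are unchanged
  obtain ⟨v, hv, hvu⟩ := exists_lipschitz_extension hρu hu hlam0
  have eφ : ∀ q, v (φ q) = u (φ q) := fun q => hvu _ (hφρ q)
  have eψ : ∀ q, v (ψ q) = u (ψ q) := fun q => hvu _ (hψρ q)
  have hφ' : ∀ p : X d, Aop φ p + v (φ p) = (((n : ℝ) + 1) ^ d)⁻¹ * ∑ p' ∈ B n (blk n p), (Aop φ p' + v (φ p')) :=
    fun p => by simp only [eφ]; exact hφ p
  have hψ' : ∀ p : X d, Aop ψ p + v (ψ p) = (((n : ℝ) + 1) ^ d)⁻¹ * ∑ p' ∈ B n (blk n p), (Aop ψ p' + v (ψ p')) :=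
    fun p => by simp only [eψ]; exact hψ p
  exact abs_le_two_radius_of_coarse_letter n hμ0 (v := fun y => Dop (φ - ψ) y) hω p hnear (fun y => abs_apply_le_norm _ y)
    fun ρ hρ ⟨Mρ, hρb⟩ Rv' hv' => by
      rw [mul_assoc]
      exact weighted_pair_apriori hd n ha Dop Aop Pop hD hA hP hlam0 hv hμ0 hμH hμU hsmall hρ hρb hφ' hψ' hv' p

/-- **THE REGION LETTER FOR THE GRADIENT OF A PAIR** (`d ≥ 3`; §2a's hypotheses + the owner's weighted chart-gradient letter
at `(n, μ)` with constants `(C_H(μ), C_Γ′(μ))` for every admissible weight): if the block means of `φ − ψ` are `≤ ω` on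
`{y : |y − blk p|_∞ < D}` (`ω ≥ 0`), then `|(φ − ψ)(p+e_ν) − (φ − ψ)(p)| ≤ (n+1)⁻¹·K₁′(μ)·(ω + ‖Q′(φ − ψ)‖·e^{−μD})`. [folklore] -/
theorem region_pair_gradient (hd : 3 ≤ d) (ha : 0 < a) {CΓ' : ℝ} (hCΓ' : 0 ≤ CΓ')
    (hD : ∀ (f : lp (fun _ : X d => ℝ) ∞) (y : X d), Dop f y = (((n : ℝ) + 1) ^ d)⁻¹ * ∑ p ∈ B n y, f p)
    (hA : ∀ (f : lp (fun _ : X d => ℝ) ∞) (p : X d), Aop f p = ∑ r ∈ nbhd n p, AX n a p r * f r)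
    (hP : ∀ (f : lp (fun _ : X d => ℝ) ∞) (p : X d), Pop f p = f p - (((n : ℝ) + 1) ^ d)⁻¹ * ∑ p' ∈ B n (blk n p), f p')
    (hgrad : ∀ {ρ : X d → ℝ}, (∀ x y, ρ x - ρ y ≤ dist x y) →
      ∀ (φ : lp (fun _ : X d => ℝ) ∞) {Rv Rκ : ℝ},
        (∀ y, Real.exp (μ * ρ y) * |Dop φ y| ≤ Rv) → (∀ q, Real.exp (μ * ρ (blk n q)) * |Pop (Aop φ) q| ≤ Rκ) →
          ∀ (p : X d) (ν : Fin d), Real.exp (μ * ρ (blk n p)) * |φ (p + e ν) - φ p|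
            ≤ ((n : ℝ) + 1)⁻¹ * (cHs d a * latticeConst d (deltaH d a - μ) * Rv + CΓ' * Rκ))
    (hlam0 : 0 ≤ lam) {ρu : ℝ} (hρu : 0 ≤ ρu) (hu : ∀ s t, |s| ≤ ρu → |t| ≤ ρu → |u s - u t| ≤ lam * |s - t|)
    (hμ0 : 0 ≤ μ) (hμH : μ < deltaH d a) (hμU : μ < deltaU d a / 4)
    (hsmall : 2 * lam * (((cG0 d * cKL d (d - 2) + cSplit d a) * Real.exp (2 * deltaU d a)
        + cFar d a * Real.exp (4 * deltaU d a) / deltaU d a ^ 2) * latticeConst d (deltaU d a / 4 - μ)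
          * (1 + cHs d a * latticeConst d (deltaH d a - μ))) < 1)
    (hφρ : ∀ q, |φ q| ≤ ρu) (hψρ : ∀ q, |ψ q| ≤ ρu)
    (hφ : ∀ p : X d, Aop φ p + u (φ p) = (((n : ℝ) + 1) ^ d)⁻¹ * ∑ p' ∈ B n (blk n p), (Aop φ p' + u (φ p')))
    (hψ : ∀ p : X d, Aop ψ p + u (ψ p) = (((n : ℝ) + 1) ^ d)⁻¹ * ∑ p' ∈ B n (blk n p), (Aop ψ p' + u (ψ p')))
    (p : X d) (ν : Fin d) {D ω : ℝ} (hω : 0 ≤ ω) (hnear : ∀ y, dist y (blk n p) < D → |Dop (φ - ψ) y| ≤ ω) :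
    |(φ - ψ) (p + e ν) - (φ - ψ) p|
      ≤ ((n : ℝ) + 1)⁻¹ * (cHs d a * latticeConst d (deltaH d a - μ)
            + CΓ' * (2 * lam * ((1 - 2 * lam * (((cG0 d * cKL d (d - 2) + cSplit d a) * Real.exp (2 * deltaU d a)
                + cFar d a * Real.exp (4 * deltaU d a) / deltaU d a ^ 2) * latticeConst d (deltaU d a / 4 - μ)
                  * (1 + cHs d a * latticeConst d (deltaH d a - μ))))⁻¹ * (cHs d a * latticeConst d (deltaH d a - μ)))))
        * (ω + ‖Dop (φ - ψ)‖ * Real.exp (-(μ * D))) := by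
  obtain ⟨v, hv, hvu⟩ := exists_lipschitz_extension hρu hu hlam0
  have eφ : ∀ q, v (φ q) = u (φ q) := fun q => hvu _ (hφρ q)
  have eψ : ∀ q, v (ψ q) = u (ψ q) := fun q => hvu _ (hψρ q)
  have hφ' : ∀ p : X d, Aop φ p + v (φ p) = (((n : ℝ) + 1) ^ d)⁻¹ * ∑ p' ∈ B n (blk n p), (Aop φ p' + v (φ p')) :=
    fun p => by simp only [eφ]; exact hφ p
  have hψ' : ∀ p : X d, Aop ψ p + v (ψ p) = (((n : ℝ) + 1) ^ d)⁻¹ * ∑ p' ∈ B n (blk n p), (Aop ψ p' + v (ψ p')) :=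
    fun p => by simp only [eψ]; exact hψ p
  exact abs_le_two_radius_of_coarse_letter n hμ0 (v := fun y => Dop (φ - ψ) y) hω p hnear (fun y => abs_apply_le_norm _ y)
    fun ρ hρ ⟨Mρ, hρb⟩ Rv' hv' => by
      have hR : ∀ q, Real.exp (μ * ρ (blk n q)) * |(φ - ψ) q| ≤ _ := fun q =>
        weighted_pair_apriori hd n ha Dop Aop Pop hD hA hP hlam0 hv hμ0 hμH hμU hsmall hρ hρb hφ' hψ' hv' q
      have h := weighted_diff_le_of_background_pair hCΓ' hP (fun φ' Rv Rκ hw hκ' => hgrad hρ φ' hw hκ') hlam0 hv hφ' hψ' hv' hR p ν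
      refine h.trans (le_of_eq ?_)
      ring

end Region

/-! ## §3. The instance on (60)'s background -/

/-- **THE SMALL-FIELD REGION LETTERS OF THE INTERACTING BACKGROUND** (`d ≥ 3`, `a > 0`; (60)'s data `u 0 = 0`, `|u′| ≤ λ`, `u′`
`L`-Lipschitz, `N ≥ N_∞`, `2λ ≤ c < N⁻¹`, `r ≥ 0`; an admissible rate `0 ≤ μ < δ_H`, `μ < δ_u∕4` with `2λC_Γ(μ) < 1`).  There is ONE
`A′ ≥ 0` such that for EVERY side `n + 1`, (60)'s operators `Q′, A, P` and background `σ` exist with the displayed actions, `σ 0 = 0`,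
the closed-ball letters and the Lipschitz letter, AND: for all `w, w′` with `‖w‖, ‖w′‖ ≤ (N⁻¹ − c)r`, every site `p`, radius `D` and
`ω ≥ 0` with `|(w′ − w)(y)| ≤ ω` whenever `|y − blk p|_∞ < D`:
`|(σw′ − σw)(p)| ≤ K₁(μ)·(ω + ‖w′ − w‖e^{−μD})` and `|(σw′ − σw)(p+e_ν) − (σw′ − σw)(p)| ≤ (n+1)⁻¹·K₁′(μ)·(ω + ‖w′ − w‖e^{−μD})`;
and every constant field `φ ≡ c₀` with `‖φ‖ ≤ r` satisfies `Q′φ = φ`, `σφ = φ`. [folklore] -/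
theorem exists_background_region (hd : 3 ≤ d) {a : ℝ} (ha : 0 < a)
    {u u' : ℝ → ℝ} (hu : ∀ t, HasDerivAt u (u' t) t) (hu0 : u 0 = 0) {lam c N : ℝ≥0} (hlam : ∀ t, |u' t| ≤ lam)
    {L : ℝ} (hL0 : 0 ≤ L) (hL : ∀ s t, |u' s - u' t| ≤ L * |s - t|)
    (hN : cHs d a * latticeConst d (deltaH d a)
        + ((cG0 d * cKL d (d - 2) + cSplit d a) * Real.exp (2 * deltaU d a)
            + cFar d a * Real.exp (4 * deltaU d a) / deltaU d a ^ 2) * latticeConst d (deltaU d a / 4)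
          * (1 + cHs d a * latticeConst d (deltaH d a)) ≤ (N : ℝ))
    (hc : 2 * lam ≤ c) (hcN : c < N⁻¹) {r : ℝ} (hr : 0 ≤ r)
    {μ : ℝ} (hμ0 : 0 ≤ μ) (hμH : μ < deltaH d a) (hμU : μ < deltaU d a / 4)
    (hsmall : 2 * (lam : ℝ) * (((cG0 d * cKL d (d - 2) + cSplit d a) * Real.exp (2 * deltaU d a)
        + cFar d a * Real.exp (4 * deltaU d a) / deltaU d a ^ 2) * latticeConst d (deltaU d a / 4 - μ)
          * (1 + cHs d a * latticeConst d (deltaH d a - μ))) < 1) :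
    ∃ A' : ℝ, 0 ≤ A' ∧ ∀ n : ℕ,
    ∃ (Dop Aop Pop : lp (fun _ : X d => ℝ) ∞ →L[ℝ] lp (fun _ : X d => ℝ) ∞)
      (σ : lp (fun _ : X d => ℝ) ∞ → lp (fun _ : X d => ℝ) ∞),
      (∀ (f : lp (fun _ : X d => ℝ) ∞) (y : X d), Dop f y = (((n : ℝ) + 1) ^ d)⁻¹ * ∑ p ∈ B n y, f p) ∧
      (∀ (f : lp (fun _ : X d => ℝ) ∞) (p : X d), Aop f p = ∑ r ∈ nbhd n p, AX n a p r * f r) ∧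
      (∀ (f : lp (fun _ : X d => ℝ) ∞) (p : X d), Pop f p = f p - (((n : ℝ) + 1) ^ d)⁻¹ * ∑ p' ∈ B n (blk n p), f p') ∧
      σ 0 = 0 ∧
      (∀ w ∈ closedBall (0 : lp (fun _ : X d => ℝ) ∞) (((N : ℝ)⁻¹ - c) * r),
        σ w ∈ closedBall 0 r ∧ Dop (σ w) = w ∧
          ∀ p : X d, Aop (σ w) p + u (σ w p)
            = (((n : ℝ) + 1) ^ d)⁻¹ * ∑ p' ∈ B n (blk n p), (Aop (σ w) p' + u (σ w p'))) ∧
      LipschitzOnWith (N⁻¹ - c)⁻¹ σ (closedBall (0 : lp (fun _ : X d => ℝ) ∞) (((N : ℝ)⁻¹ - c) * r)) ∧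
      (∀ w ∈ closedBall (0 : lp (fun _ : X d => ℝ) ∞) (((N : ℝ)⁻¹ - c) * r),
        ∀ w' ∈ closedBall (0 : lp (fun _ : X d => ℝ) ∞) (((N : ℝ)⁻¹ - c) * r),
        ∀ (p : X d) (D ω : ℝ), 0 ≤ ω → (∀ y, dist y (blk n p) < D → |(w' - w) y| ≤ ω) →
          |(σ w' - σ w) p|
            ≤ (1 - 2 * (lam : ℝ) * (((cG0 d * cKL d (d - 2) + cSplit d a) * Real.exp (2 * deltaU d a)
                + cFar d a * Real.exp (4 * deltaU d a) / deltaU d a ^ 2) * latticeConst d (deltaU d a / 4 - μ)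
                  * (1 + cHs d a * latticeConst d (deltaH d a - μ))))⁻¹
              * (cHs d a * latticeConst d (deltaH d a - μ)) * (ω + ‖w' - w‖ * Real.exp (-(μ * D))) ∧
          ∀ ν : Fin d, |(σ w' - σ w) (p + e ν) - (σ w' - σ w) p|
            ≤ ((n : ℝ) + 1)⁻¹ * (cHs d a * latticeConst d (deltaH d a - μ)
                + (A' * latticeConst d (deltaU d a / 4 - μ) + cHs d a * latticeConst d (deltaH d a - μ)
                    * (((cG0 d * cKL d (d - 2) + cSplit d a) * Real.exp (2 * deltaU d a)
                        + cFar d a * Real.exp (4 * deltaU d a) / deltaU d a ^ 2) * latticeConst d (deltaU d a / 4 - μ)))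
                  * (2 * lam * ((1 - 2 * (lam : ℝ) * (((cG0 d * cKL d (d - 2) + cSplit d a) * Real.exp (2 * deltaU d a)
                      + cFar d a * Real.exp (4 * deltaU d a) / deltaU d a ^ 2) * latticeConst d (deltaU d a / 4 - μ)
                        * (1 + cHs d a * latticeConst d (deltaH d a - μ))))⁻¹
                    * (cHs d a * latticeConst d (deltaH d a - μ)))))
              * (ω + ‖w' - w‖ * Real.exp (-(μ * D)))) ∧
      (∀ (φ : lp (fun _ : X d => ℝ) ∞) (c₀ : ℝ), (∀ q, φ q = c₀) → ‖φ‖ ≤ r → Dop φ = φ ∧ σ φ = φ) := by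
  obtain ⟨A', hA0, hgradAll⟩ := exists_chart_gradient_weighted hd ha
  refine ⟨A', hA0, fun n => ?_⟩
  obtain ⟨Dop, Aop, Pop, hD, hA, hP, hgrad⟩ := hgradAll n
  obtain ⟨Dop', Aop', Pop', σ, hD', hA', hP', hσ0, hσ, hlip, huniq, -⟩ :=
    exists_background hd n ha hu hu0 hlam hL0 hL hN hc hcN hr
  have eD : Dop' = Dop := ContinuousLinearMap.ext fun f => lp.ext (funext fun p => by rw [hD, hD'])
  have eA : Aop' = Aop := ContinuousLinearMap.ext fun f => lp.ext (funext fun p => by rw [hA, hA'])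
  have eP : Pop' = Pop := ContinuousLinearMap.ext fun f => lp.ext (funext fun p => by rw [hP, hP'])
  subst eD eA eP
  have hul : ∀ s t, |u s - u t| ≤ (lam : ℝ) * |s - t| := fun s t => by
    have hderiv : ∀ x ∈ uIcc t s, HasDerivWithinAt u (u' x) (uIcc t s) x := fun x _ => (hu x).hasDerivWithinAt
    have hbound : ∀ x ∈ uIcc t s, ‖u' x‖ ≤ lam := fun x _ => by rw [Real.norm_eq_abs]; exact hlam x
    have h := Convex.norm_image_sub_le_of_norm_hasDerivWithin_le hderiv hbound (convex_uIcc t s) left_mem_uIcc right_mem_uIcc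
    rwa [Real.norm_eq_abs, Real.norm_eq_abs] at h
  have hCH0 : 0 ≤ cHs d a * latticeConst d (deltaH d a - μ) :=
    mul_nonneg (cHs_nonneg d ha) (latticeConst_nonneg d (sub_pos.2 hμH).le)
  have hCΓ' : 0 ≤ A' * latticeConst d (deltaU d a / 4 - μ) + cHs d a * latticeConst d (deltaH d a - μ)
      * (((cG0 d * cKL d (d - 2) + cSplit d a) * Real.exp (2 * deltaU d a)
          + cFar d a * Real.exp (4 * deltaU d a) / deltaU d a ^ 2) * latticeConst d (deltaU d a / 4 - μ)) :=
    add_nonneg (mul_nonneg hA0 (latticeConst_nonneg d (sub_pos.2 hμU).le))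
      (mul_nonneg hCH0 (mul_nonneg (supConstG_nonneg d ha) (latticeConst_nonneg d (sub_pos.2 hμU).le)))
  refine ⟨Dop', Aop', Pop', σ, hD', hA', hP', hσ0, hσ, hlip, fun w hw w' hw' p D ω hω hnear => ?_,
    fun φ c₀ hφ hφr => background_const_of_letters n Dop' Aop' σ hD' hA' huniq hφ hφr⟩
  obtain ⟨-, hDw, hEw⟩ := hσ w hw
  obtain ⟨-, hDw', hEw'⟩ := hσ w' hw'
  have hDd : Dop' (σ w' - σ w) = w' - w := by rw [map_sub, hDw, hDw']
  have hnear' : ∀ y, dist y (blk n p) < D → |Dop' (σ w' - σ w) y| ≤ ω := fun y hy => by rw [hDd]; exact hnear y hy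
  have hbw' : ∀ q, |σ w' q| ≤ r := fun q => (abs_apply_le_norm (σ w') q).trans (by
    have h := (hσ w' hw').1; rwa [mem_closedBall, dist_zero_right] at h)
  have hbw : ∀ q, |σ w q| ≤ r := fun q => (abs_apply_le_norm (σ w) q).trans (by
    have h := (hσ w hw).1; rwa [mem_closedBall, dist_zero_right] at h)
  have hulw : ∀ s t, |s| ≤ r → |t| ≤ r → |u s - u t| ≤ (lam : ℝ) * |s - t| := fun s t _ _ => hul s t
  refine ⟨?_, fun ν => ?_⟩
  · have h := region_pair_value hd ha hD' hA' hP' (NNReal.coe_nonneg lam) hr hulw hμ0 hμH hμU hsmall hbw' hbw hEw' hEw p hω hnear'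
    rwa [hDd] at h
  · have h := region_pair_gradient hd ha hCΓ' hD' hA' hP' (fun hρ φ' Rv Rκ hv' hκ' => hgrad hμ0 hμH hμU hρ φ' hv' hκ')
      (NNReal.coe_nonneg lam) hr hulw hμ0 hμH hμU hsmall hbw' hbw hEw' hEw p ν hω hnear'
    rwa [hDd] at h

/-! ## §4. Toy -/

/-- Toy: the region letter's shape — with `K₁ = 3`, near oscillation `ω = 1∕100`, global difference `‖w′ − w‖ = 2`, rate `μ = 1` and
`D` blocks of agreement the background moves at `p` by at most `3·(1∕100 + 2e^{−D})`; at `D = 0` this is `3·(1∕100 + 2)`. -/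
example : (3 : ℝ) * (1 / 100 + 2 * Real.exp (-(1 * 0))) = 3 * (1 / 100 + 2) := by norm_num

end Summit.QuantumFields.BalabanUV.T4Continuum.NE7b.SupBackgroundRegionInstance

end
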